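import Summits.QuantumFields.YangMills.Theorems.BalabanUVNodesN09TowerChartOfPerBondCharts
import Literature.MathematicalPhysics.QuantumFieldTheory.Balaban1983to89.Node00.BetaInputIntegrable

/-!
# NODE N09 [B12] — THE CONFINEMENT SOCKET `hconf` OF THE (F1) REGULARITY TOWER HOLDS FOR ROAD A′ RE-BASED ON THE χ-SUPPORT: near every small coarse field, the tower
# chart of the private-coordinate road takes values in ONE COMPACT SUBSET of the step-`j` small-field domain, with a constant integrable bound on its Jacobian

Cell `pub-ymgap` (YM-PLAN Track A), width seat `pub-ymgap-dag-n09-w5` g4 (D-0154 ∕ R399 (3a) width seat 5 of node N09), FILE 4; helper of K1⁹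
`StabilityBRunRowsAtRecordR13SepCoPHV` = stmt-QuantumFields-27364 (`--supports`, `--as helper`, count-neutral).  [I] = [Balaban1987RG1] (CMP 109), [B7] = [Balaban1985Averaging],
[B11] = [Balaban1985Variational], [III] = [Balaban1988Convergent].

WHY.  dag-n09-w1 g5's regularity tower (`…N09RegularityTowerOfGeometricChartData.hreg_pos_all_of_geometricChartData`, p622064) asks per step, besides the four measure-theoretic
sockets supplied for road A′ by FILES 2–3 (`…N09TowerChartOfPerBondCharts[AtRecord]`), the CONFINEMENT socket `hconf`: near every `V₀ ∈ domAlt_{j+1}` the chart `Φ j (V, ·)` takes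
(a.e.) values in a COMPACT `C ⊆ domAlt_j` and the Jacobian is dominated by an integrable bound — print's «the (2.10) box maps into the current small-field domain by the threshold
hierarchy, with margin».  For the raw private-coordinate chart this is hopeless (`Φ_tri(V,·)` sweeps the whole fibre); for the RE-BASED chart `Φ′ = A.piecewise Φ_tri (V^{(j)} ∘ fst)`,
`A = {J_tri ≠ 0} ∩ Φ_tri⁻¹{χ^{(2.9)}_j ≠ 0}`, it is a THEOREM of the record: on `A`, `Φ_tri(V,U)` lies in the fibre over `V` (`hright`) and has `χ^{(2.9)}_j = 1`, so — [I] p. 266–267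
rider at the record (dag-n09-w4 g3 `…N09B0RiderAtRecord.hb0_of_hsolν_of_numerics`) for the distinguished bonds, (2.9) for the others — EVERY fluctuation variable against
`V^{(j)}(V)` is `≤ max(ε₂₉, ε′)`, whence (K0e's group algebra `T4ExpWindowSmallField.dist1_plaqHol_le_add` ∕ `plaqDev_le_four_mul`) `|∂Φ′ − 1| ≤ |∂V^{(j)}(V) − 1| + 4·max(ε₂₉, ε′)`;
off `A`, `Φ′ = V^{(j)}(V)`.  Since `V ↦ V^{(j)}(V)` is continuous on the domain (`hcrit`, N07 ∕ selector content, DISPLAYED as in the tower) and `|∂V^{(j)}(V₀) − 1| < 2εreg∕L²`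
([B7] Prop 2 at the record, dag-n09-w1 g2 `…N09NestingOfHierAxial.hcrit_of_ukExists`), there is a margin `M < 2εreg∕L²` valid for all `V` near `V₀` (finitely many plaquettes,
`Filter.eventually_all`), and `C := {U | ∀ p, |∂U(p) − 1| ≤ M + 4·max(ε₂₉, ε′)}` is closed, hence compact, and inside `domAlt_j` by the threshold ordering `hord`
(`2εreg∕L² + 4·max(ε₂₉, ε′) ≤ ε₀`, [III] p. 265).  The Jacobian bound is the constant `B^{#bonds}` from a displayed uniform bound `jd ≤ B` on the inverse densities.

WHAT IS PROVED (theorems only; 0 def, 0 instance, 0 notation, 0 sorry).  One level `j < K`.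
* §1 `dist1_plaqHol_le_of_fluct` (the quantitative threshold-hierarchy bound: all fluctuation variables of `U` against `U₀` are `≤ τ` ⇒ `|∂U(p) − 1| ≤ |∂U₀(p) − 1| + 4τ`) ·
  ★★ `dist1_plaqHol_triChart_le_of_mem_rebaseSet` (on `A`, with `V ∈ domAlt_{j+1}`: `|∂Φ_tri(V,U)(p) − 1| ≤ |∂V^{(j)}(V)(p) − 1| + 4·max(ε₂₉, ε′)` — rider + (2.9) + `hright`) ·
  `towerJacobian_le_pow` (`J′ ≤ B^{#bonds}` under `jd ≤ B`) · `isCompact_plaqBall` (`{U | ∀ p, |∂U(p) − 1| ≤ r}` is compact) · `plaqBall_subset_domAlt` (`r < ε₀` ⇒ it lies in `domAlt_j`).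
* §2 ★★★ `tower_hconf_of_perBondCharts_of_hsolν_of_numerics` — the tower's `hconf` socket at level `j` for `(Φ′, J′)` at `Z j := GaugeField (F.P K) j (SU N)`, `τ j := fieldMeasure`,
  binder shape VERBATIM, from: road-A′ data `(T, ϑ, jd; hright)`, a uniform bound `jd ≤ B`, `hcrit : ContinuousOn V^{(j)} domAlt_{j+1}` (displayed, as in the tower),
  [B11]-existence `hsolν`, dag-n09-w4 g3's seven numerics + `hord`.

HONEST FRAMING.  LOCATED, count-neutral topology ∕ kernel bookkeeping BY NAME; `hcrit` (N07's [B11] Thm 1 for a continuous selector), `hsolν`, the per-bond data, `jd ≤ B` and the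
numerics stay DISPLAYED; NO Jacobian law, NO `hnull`, NO continuity socket (`hΦV hJV hz₀ hΦc hJpos` remain — they need the forward map's openness ∕ continuity of `ϑ`, `jd`);
NOTHING of Bałaban's proved or denied; `hreg` NOT discharged; N09 NOT discharged; conjunct 1 (Lemma 4) and FLAG №7 untouched; K0⁷ ∕ K1⁹ ∕ K3⁸ NOT closed; counts unmoved (typed
28∕28 · discharged 5∕28); no summit statement is proved by this seat; one finite four-torus programme at fixed `ε = L^{−K}` per run — R4 closes the conditional rung
`BalabanLadder.UV` only; NOT continuum ∕ ℝ⁴ ∕ infinite volume ∕ OS; the Yang–Mills mass gap (Clay) is NOT proved by any of this.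
-/

noncomputable section

namespace Summit.QuantumFields.YangMills.BalabanUVNodes.N09TowerConfinementOfPerBondCharts

open MeasureTheory Set Function Filter Topology
open scoped ENNReal NNReal
open Literature.MathematicalPhysics.QuantumFieldTheory.Balaban1983to89
open Literature.MathematicalPhysics.QuantumFieldTheory.Balaban1983to89.T4Continuum (T4Family)
open Literature.MathematicalPhysics.QuantumFieldTheory.Balaban1983to89.Node00
open Literature.MathematicalPhysics.QuantumFieldTheory.Balaban1983to89.ExpMeanLog (deltaSU)
open Literature.MathematicalPhysics.QuantumFieldTheory.Balaban1983to89.BlockAveragingHaarAC (centralBond)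
open Literature.MathematicalPhysics.QuantumFieldTheory.Balaban1983to89.T4TiltOscillation (bdev)
open Literature.MathematicalPhysics.QuantumFieldTheory.Balaban1983to89.T4ExpWindowSmallField (plaqDev plaqDev_le_four_mul dist1_plaqHol_le_add)
open Literature.MathematicalPhysics.QuantumFieldTheory.Balaban1983to89.B12ContinuousTransportInvarianceOn (continuous_dist1_SU continuous_plaqHol_SU isOpen_domAltOfRecord)
open N09HregOfPerBondChartsAtRecord (avOfRecord_triChart_eq_of_jacobian_ne_zero)
open N09TowerChartOfPerBondCharts (towerChart_eq_of_mem towerChart_eq_of_not_mem)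
open N09B0RiderAtRecord (hb0_of_hsolν_of_numerics)
open N09NestingOfHierAxial (hcrit_of_ukExists)

variable {F : T4Family} {N : ℕ} [NeZero N]

/-! ## §1  The quantitative threshold hierarchy on the rebase set; the Jacobian bound; compact plaquette balls -/

section Generic

variable {P : Params} {j : ℕ}

omit [NeZero N] in
/-- **QUANTITATIVE THRESHOLD HIERARCHY** (the calc inside K0e's `Node00.SmallFieldChi29OfRecord.mem_domAltOfRecord_of_chiFix29_eq_one`, kept as a bound): if every fluctuation
variable of `U` against `U₀` is `≤ τ` then `|∂U(p) − 1| ≤ |∂U₀(p) − 1| + 4τ` at every plaquette. [cite: Balaban1988Convergent, p.265; Balaban1989LargeFieldI, Prop. 1 (1.78) p.194] -/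
theorem dist1_plaqHol_le_of_fluct {G : Type*} [GaugeGroup G] {U U₀ : GaugeField P j G} {τ : ℝ} (hb : ∀ b, dist1 (bdev U U₀ b) ≤ τ) (p : Plaq P j) :
    dist1 (GaugeField.plaqHol U p) ≤ dist1 (GaugeField.plaqHol U₀ p) + 4 * τ :=
  (dist1_plaqHol_le_add U U₀ p).trans (add_le_add le_rfl (plaqDev_le_four_mul hb p))

/-- **A CLOSED PLAQUETTE BALL IS COMPACT**: `{U | ∀ p, |∂U(p) − 1| ≤ r}` is closed in the compact configuration space `SU(N)^{bonds}`.
[cite: Balaban1987RG1, (0.18) p.255 and p.259 (bookkeeping)] -/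
theorem isCompact_plaqBall (r : ℝ) : IsCompact {U : GaugeField P j (SU N) | ∀ p : Plaq P j, dist1 (GaugeField.plaqHol U p) ≤ r} := by
  haveI : CompactSpace (GaugeField P j (SU N)) := inferInstanceAs (CompactSpace (PBond P j → SU N))
  have h : {U : GaugeField P j (SU N) | ∀ p : Plaq P j, dist1 (GaugeField.plaqHol U p) ≤ r} =
      ⋂ p : Plaq P j, {U | dist1 (GaugeField.plaqHol U p) ≤ r} := by
    ext U; simp only [mem_setOf_eq, mem_iInter]
  rw [h]
  exact (isClosed_iInter fun p => isClosed_le (continuous_dist1_SU.comp (continuous_plaqHol_SU p)) continuous_const).isCompact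

/-- … and it lies inside the record's small-field domain as soon as `r < ε₀`. [cite: Balaban1987RG1, (0.18) p.255 and p.259] -/
theorem plaqBall_subset_domAlt (ν : Stage7Numerics) (K k : ℕ) {r : ℝ} (hr : r < ν.ε₀) :
    {U : GaugeField (F.P K) k (SU N) | ∀ p : Plaq (F.P K) k, dist1 (GaugeField.plaqHol U p) ≤ r} ⊆ domAltOfRecord F N ν K k :=
  fun U hU => (mem_domAltOfRecord_iff F N ν K k U).2 fun p => (hU p).trans_lt hr

end Generic

section Level

variable {K j : ℕ} (T : PBond (F.P K) (j + 1) → GaugeField (F.P K) j (SU N) → Set (SU N))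
  (ϑ : PBond (F.P K) (j + 1) → GaugeField (F.P K) j (SU N) → SU N → SU N)
  (jd : PBond (F.P K) (j + 1) → GaugeField (F.P K) j (SU N) → SU N → ℝ≥0)

omit [NeZero N] in
/-- **THE TOWER JACOBIAN IS DOMINATED BY A CONSTANT**: `J′ ≤ J_tri ≤ ∏_c jd_c ≤ B^{#bonds}` under a uniform bound `jd ≤ B` on the inverse densities (displayed).
[cite: Balaban1987RG1, (2.10) p.267 (bookkeeping)] -/
theorem towerJacobian_le_pow (R : Set (GaugeField (F.P K) j (SU N))) {B : ℝ≥0} (hjdB : ∀ c U v, jd c U v ≤ B) (p : ((PBond (F.P K) (j + 1) → SU N) × GaugeField (F.P K) j (SU N))) :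
    (({p : ((PBond (F.P K) (j + 1) → SU N) × GaugeField (F.P K) j (SU N)) | ({q : ((PBond (F.P K) (j + 1) → SU N) × GaugeField (F.P K) j (SU N)) | ∀ c, q.1 c ∈ T c q.2}.indicator fun q => ∏ c, jd c q.2 (q.1 c)) p ≠ 0 ∧
        (extend centralBond (fun c => ϑ c p.2 (p.1 c)) p.2 : GaugeField (F.P K) j (SU N)) ∈ R}.indicator ({q : ((PBond (F.P K) (j + 1) → SU N) × GaugeField (F.P K) j (SU N)) | ∀ c, q.1 c ∈ T c q.2}.indicator fun q => ∏ c, jd c q.2 (q.1 c)) p : ℝ≥0) : ℝ) ≤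
      ((B : ℝ≥0) : ℝ) ^ Fintype.card (PBond (F.P K) (j + 1)) := by
  have h1 : {p : ((PBond (F.P K) (j + 1) → SU N) × GaugeField (F.P K) j (SU N)) | ({q : ((PBond (F.P K) (j + 1) → SU N) × GaugeField (F.P K) j (SU N)) | ∀ c, q.1 c ∈ T c q.2}.indicator fun q => ∏ c, jd c q.2 (q.1 c)) p ≠ 0 ∧
        (extend centralBond (fun c => ϑ c p.2 (p.1 c)) p.2 : GaugeField (F.P K) j (SU N)) ∈ R}.indicator ({q : ((PBond (F.P K) (j + 1) → SU N) × GaugeField (F.P K) j (SU N)) | ∀ c, q.1 c ∈ T c q.2}.indicator fun q => ∏ c, jd c q.2 (q.1 c)) p ≤ ({q : ((PBond (F.P K) (j + 1) → SU N) × GaugeField (F.P K) j (SU N)) | ∀ c, q.1 c ∈ T c q.2}.indicator fun q => ∏ c, jd c q.2 (q.1 c)) p :=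
    Set.indicator_le_self _ _ p
  have h2 : ({q : ((PBond (F.P K) (j + 1) → SU N) × GaugeField (F.P K) j (SU N)) | ∀ c, q.1 c ∈ T c q.2}.indicator fun q => ∏ c, jd c q.2 (q.1 c)) p ≤ ∏ c, jd c p.2 (p.1 c) := Set.indicator_le_self _ _ p
  have h3 : ∏ c, jd c p.2 (p.1 c) ≤ B ^ Fintype.card (PBond (F.P K) (j + 1)) := by
    rw [← Finset.card_univ]
    exact Finset.prod_le_pow_card _ _ _ fun c _ => hjdB c p.2 (p.1 c)
  have h := (h1.trans h2).trans h3
  rw [← NNReal.coe_pow]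
  exact_mod_cast h

/-- ★★ **ON THE REBASE SET THE PRIVATE-COORDINATE CHART HAS SMALL PLAQUETTES RELATIVE TO THE CRITICAL CONFIGURATION**: for `j < K`, `V ∈ domAlt_{j+1}` and `U` a fine field with
`(V, U) ∈ A` (`J_tri(V,U) ≠ 0` and `χ^{(2.9)}_j(Φ_tri(V,U)) ≠ 0`): `|∂Φ_tri(V,U)(p) − 1| ≤ |∂V^{(j)}(V)(p) − 1| + 4·max(ε₂₉, ε′)` at every plaquette — `Φ_tri(V,U)` lies over `V`
(dag-n09-w6 g3's `avOfRecord_triChart_eq_of_jacobian_ne_zero`, from `hright`), its (2.9) variables are `< ε₂₉` (`χ = 1`) and its distinguished variables `≤ ε′` (dag-n09-w4 g3's rider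
`hb0_of_hsolν_of_numerics`, from `hsolν` + numerics).  CONDITIONAL; nothing of Bałaban's asserted.
[cite: Balaban1987RG1, (2.9) p.266, p.267 and (2.3) p.265; Balaban1988Convergent, p.265; Balaban1985Averaging, Prop. 2 (53) p.26] -/
theorem dist1_plaqHol_triChart_le_of_mem_rebaseSet (θ₀ : Stage13Params F N) (g : ℕ → ℝ) [DecidableEq (PBond (F.P K) j)] (hj : j < K)
    (hright : ∀ c U, ∀ v ∈ T c U, (avOfRecord F N K j).avg (update U (centralBond c) (ϑ c U v)) c = v)
    (hεreg : 0 < θ₀.ν.εreg)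
    (hε3 : (143 * (((((F.P K).d + 4 : ℕ) : ℝ)) ^ 2 / 4) ^ 2) * θ₀.ν.εreg ≤ 1 / 3)
    (hε2 : 2 * θ₀.ν.εreg ≤ 2 * deltaSU (Fin N) / ((((F.P K).d + 4) * (F.P K).L : ℕ) : ℝ) ^ 2) (hε29 : 0 ≤ θ₀.ε₂₉)
    (hn1 : 1640 * (2 * (((((F.P K).d + 2) * (F.P K).L : ℕ) : ℝ) * θ₀.ε₂₉) +
        ((((F.P K).d + 2) * (F.P K).L : ℕ) : ℝ) ^ 2 / 4 * (2 * θ₀.ν.εreg / ((F.P K).L : ℝ) ^ 2)) * (((F.P K).L : ℝ) ^ ((F.P K).d - 1)) ^ 2 ≤ 1)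
    (hn2 : 13 * (2 * (((((F.P K).d + 2) * (F.P K).L : ℕ) : ℝ) * θ₀.ε₂₉) +
        ((((F.P K).d + 2) * (F.P K).L : ℕ) : ℝ) ^ 2 / 4 * (2 * θ₀.ν.εreg / ((F.P K).L : ℝ) ^ 2)) * ((F.P K).L : ℝ) ^ ((F.P K).d - 1) < deltaSU (Fin N))
    (hsolν : ∀ j < K, ∀ W ∈ domAltOfRecord F N θ₀.ν K (j + 1), UkExists F N K (j + 1) θ₀.ν.εreg W)
    {V : PBond (F.P K) (j + 1) → SU N} (hV : V ∈ domAltOfRecord F N θ₀.ν K (j + 1)) {U : GaugeField (F.P K) j (SU N)}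
    (hA : (V, U) ∈ {p : ((PBond (F.P K) (j + 1) → SU N) × GaugeField (F.P K) j (SU N)) |
          ({q : ((PBond (F.P K) (j + 1) → SU N) × GaugeField (F.P K) j (SU N)) | ∀ c, q.1 c ∈ T c q.2}.indicator fun q => ∏ c, jd c q.2 (q.1 c)) p ≠ 0 ∧
            (extend centralBond (fun c => ϑ c p.2 (p.1 c)) p.2 : GaugeField (F.P K) j (SU N)) ∈
              {U : GaugeField (F.P K) j (SU N) | chiFixed29 F N θ₀.ν θ₀.ε₂₉ K g j U ≠ 0}}) (p : Plaq (F.P K) j) :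
    dist1 (GaugeField.plaqHol (extend centralBond (fun c => ϑ c U (V c)) U : GaugeField (F.P K) j (SU N)) p) ≤
      dist1 (GaugeField.plaqHol (critCfgOfRecord F N θ₀.ν K j V) p) + 4 * max θ₀.ε₂₉ (10 * (((((F.P K).d + 2) * (F.P K).L : ℕ) : ℝ) * θ₀.ε₂₉) * ((F.P K).L : ℝ) ^ ((F.P K).d - 1)) := by
  set W : GaugeField (F.P K) j (SU N) := extend centralBond (fun c => ϑ c U (V c)) U with hW
  -- the chart lies over `V`
  have havg : (avOfRecord F N K j).avg W = V := avOfRecord_triChart_eq_of_jacobian_ne_zero T ϑ jd hj hright hA.1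
  have havgD : (avOfRecord F N K j).avg W ∈ domAltOfRecord F N θ₀.ν K (j + 1) := by rw [havg]; exact hV
  -- `χ^{(2.9)}_j(W) = 1`
  have hχ1 : chiβOfRecord₁₃ F N θ₀ K g j W = 1 := by
    rcases chiFix29OfRecord_eq_zero_or_one θ₀.ν θ₀.ε₂₉ K j W with h0 | h1
    · exact absurd h0 hA.2
    · exact h1
  -- every fluctuation variable against `V^{(j)}(V)` is `≤ max(ε₂₉, ε′)`
  have hb : ∀ b : PBond (F.P K) j, dist1 (bdev W (critCfgOfRecord F N θ₀.ν K j V) b) ≤ max θ₀.ε₂₉ (10 * (((((F.P K).d + 2) * (F.P K).L : ℕ) : ℝ) * θ₀.ε₂₉) * ((F.P K).L : ℝ) ^ ((F.P K).d - 1)) := by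
    intro b
    have hdev : fluctDevOfRecord F N θ₀.ν K j W b = dist1 (bdev W (critCfgOfRecord F N θ₀.ν K j V) b) := by
      rw [fluctDevOfRecord_apply, havg]; rfl
    by_cases hb0 : IsB0 b
    · have h := hb0_of_hsolν_of_numerics θ₀ K g hεreg hε3 hε2 hε29 hn1 hn2 hsolν j hj W havgD hχ1 b hb0
      rw [hdev] at h
      exact h.trans (le_max_right _ _)
    · have h := (chiFix29OfRecord_eq_one_iff θ₀.ν θ₀.ε₂₉ K j W).1 hχ1 b hb0
      rw [hdev] at h
      exact h.le.trans (le_max_left _ _)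
  exact dist1_plaqHol_le_of_fluct hb p

end Level

/-! ## §2  The confinement socket of the tower for the re-based road-A′ chart -/

/-- ★★★ **SOCKET `hconf` AT LEVEL `j` FOR ROAD A′ RE-BASED ON THE χ-SUPPORT, BINDER SHAPE OF THE TOWER VERBATIM**
(`…N09RegularityTowerOfGeometricChartData.hreg_pos_all_of_geometricChartData` at `Z j := GaugeField (F.P K) j (SU N)`, `τ j := fieldMeasure`, `Φ j := Φ′`, `J j := J′` of
`…N09TowerChartOfPerBondCharts[AtRecord]`): for every `V₀ ∈ domAlt_{j+1}` there are a COMPACT `C ⊆ domAlt_j` and an integrable `bound` with `J′(V,U) ≤ bound U` and `Φ′(V,U) ∈ C`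
for ALL fine fields `U` and all `V ∈ domAlt_{j+1}` near `V₀` — from road-A′ data `(T, ϑ, jd; hright)`, a uniform bound `jd ≤ B`, the continuity `hcrit` of `V^{(j)}` on the domain
(displayed), [B11]-existence `hsolν` and numerics.  `C` = the closed plaquette ball of radius `M + 4·max(ε₂₉, ε′)`, `M < 2εreg∕L²` a margin from `hcrit` + [B7] Prop 2 at `V₀`;
`bound` = `B^{#bonds}`.  CONDITIONAL; nothing of Bałaban's asserted; `hreg` NOT discharged.
[cite: Balaban1987RG1, p.259, (2.3) p.265, (2.9)–(2.10) pp.266–267; Balaban1985Averaging, Prop. 2 (53) p.26; Balaban1988Convergent, p.265] -/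
theorem tower_hconf_of_perBondCharts_of_hsolν_of_numerics (θ₀ : Stage13Params F N) (K : ℕ) (g : ℕ → ℝ) {j : ℕ}
    [DecidableEq (PBond (F.P K) j)] (hj : j < K)
    (T : PBond (F.P K) (j + 1) → GaugeField (F.P K) j (SU N) → Set (SU N))
    (ϑ : PBond (F.P K) (j + 1) → GaugeField (F.P K) j (SU N) → SU N → SU N)
    (jd : PBond (F.P K) (j + 1) → GaugeField (F.P K) j (SU N) → SU N → ℝ≥0)
    (hright : ∀ c U, ∀ v ∈ T c U, (avOfRecord F N K j).avg (update U (centralBond c) (ϑ c U v)) c = v)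
    {B : ℝ≥0} (hjdB : ∀ c U v, jd c U v ≤ B)
    (hεreg : 0 < θ₀.ν.εreg)
    (hε3 : (143 * (((((F.P K).d + 4 : ℕ) : ℝ)) ^ 2 / 4) ^ 2) * θ₀.ν.εreg ≤ 1 / 3)
    (hε2 : 2 * θ₀.ν.εreg ≤ 2 * deltaSU (Fin N) / ((((F.P K).d + 4) * (F.P K).L : ℕ) : ℝ) ^ 2) (hε29 : 0 ≤ θ₀.ε₂₉)
    (hn1 : 1640 * (2 * (((((F.P K).d + 2) * (F.P K).L : ℕ) : ℝ) * θ₀.ε₂₉) +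
        ((((F.P K).d + 2) * (F.P K).L : ℕ) : ℝ) ^ 2 / 4 * (2 * θ₀.ν.εreg / ((F.P K).L : ℝ) ^ 2)) * (((F.P K).L : ℝ) ^ ((F.P K).d - 1)) ^ 2 ≤ 1)
    (hn2 : 13 * (2 * (((((F.P K).d + 2) * (F.P K).L : ℕ) : ℝ) * θ₀.ε₂₉) +
        ((((F.P K).d + 2) * (F.P K).L : ℕ) : ℝ) ^ 2 / 4 * (2 * θ₀.ν.εreg / ((F.P K).L : ℝ) ^ 2)) * ((F.P K).L : ℝ) ^ ((F.P K).d - 1) < deltaSU (Fin N))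
    (hord : 2 * θ₀.ν.εreg / ((F.P K).L : ℝ) ^ 2 +
      4 * max θ₀.ε₂₉ (10 * (((((F.P K).d + 2) * (F.P K).L : ℕ) : ℝ) * θ₀.ε₂₉) * ((F.P K).L : ℝ) ^ ((F.P K).d - 1)) ≤ θ₀.ν.ε₀)
    (hsolν : ∀ j < K, ∀ W ∈ domAltOfRecord F N θ₀.ν K (j + 1), UkExists F N K (j + 1) θ₀.ν.εreg W)
    (hcrit : ContinuousOn (critCfgOfRecord F N θ₀.ν K j) (domAltOfRecord F N θ₀.ν K (j + 1)))
    [DecidablePred (· ∈ {p : ((PBond (F.P K) (j + 1) → SU N) × GaugeField (F.P K) j (SU N)) |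
          ({q : ((PBond (F.P K) (j + 1) → SU N) × GaugeField (F.P K) j (SU N)) | ∀ c, q.1 c ∈ T c q.2}.indicator fun q => ∏ c, jd c q.2 (q.1 c)) p ≠ 0 ∧
            (extend centralBond (fun c => ϑ c p.2 (p.1 c)) p.2 : GaugeField (F.P K) j (SU N)) ∈
              {U : GaugeField (F.P K) j (SU N) | chiFixed29 F N θ₀.ν θ₀.ε₂₉ K g j U ≠ 0}})] :
    ∀ V₀ ∈ domAltOfRecord F N θ₀.ν K (j + 1), ∃ C ⊆ domAltOfRecord F N θ₀.ν K j, IsCompact C ∧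
      ∃ bound : GaugeField (F.P K) j (SU N) → ℝ, Integrable bound (fieldMeasure (F.P K) j (SU N)) ∧
        ∀ᶠ V in 𝓝[domAltOfRecord F N θ₀.ν K (j + 1)] V₀, ∀ᵐ z ∂(fieldMeasure (F.P K) j (SU N)),
          (((Set.indicator {p : ((PBond (F.P K) (j + 1) → SU N) × GaugeField (F.P K) j (SU N)) |
          ({q : ((PBond (F.P K) (j + 1) → SU N) × GaugeField (F.P K) j (SU N)) | ∀ c, q.1 c ∈ T c q.2}.indicator fun q => ∏ c, jd c q.2 (q.1 c)) p ≠ 0 ∧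
            (extend centralBond (fun c => ϑ c p.2 (p.1 c)) p.2 : GaugeField (F.P K) j (SU N)) ∈
              {U : GaugeField (F.P K) j (SU N) | chiFixed29 F N θ₀.ν θ₀.ε₂₉ K g j U ≠ 0}}
        ({q : ((PBond (F.P K) (j + 1) → SU N) × GaugeField (F.P K) j (SU N)) | ∀ c, q.1 c ∈ T c q.2}.indicator fun q => ∏ c, jd c q.2 (q.1 c))) (V, z) : ℝ≥0) : ℝ) ≤ bound z ∧
            (Set.piecewise {p : ((PBond (F.P K) (j + 1) → SU N) × GaugeField (F.P K) j (SU N)) |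
          ({q : ((PBond (F.P K) (j + 1) → SU N) × GaugeField (F.P K) j (SU N)) | ∀ c, q.1 c ∈ T c q.2}.indicator fun q => ∏ c, jd c q.2 (q.1 c)) p ≠ 0 ∧
            (extend centralBond (fun c => ϑ c p.2 (p.1 c)) p.2 : GaugeField (F.P K) j (SU N)) ∈
              {U : GaugeField (F.P K) j (SU N) | chiFixed29 F N θ₀.ν θ₀.ε₂₉ K g j U ≠ 0}}
        (fun p => (extend centralBond (fun c => ϑ c p.2 (p.1 c)) p.2 : GaugeField (F.P K) j (SU N)))
        (fun p => critCfgOfRecord F N θ₀.ν K j p.1)) (V, z) ∈ C := by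
  intro V₀ hV₀
  set D := domAltOfRecord F N θ₀.ν K (j + 1) with hD
  set δ₇ : ℝ := 2 * θ₀.ν.εreg / ((F.P K).L : ℝ) ^ 2 with hδ₇
  set ε'' : ℝ := max θ₀.ε₂₉ (10 * (((((F.P K).d + 2) * (F.P K).L : ℕ) : ℝ) * θ₀.ε₂₉) * ((F.P K).L : ℝ) ^ ((F.P K).d - 1)) with hε''
  have hL0 : (0 : ℝ) < (F.P K).L := by exact_mod_cast (F.P K).L_pos
  have hδ₇pos : 0 < δ₇ := by positivity
  -- [B7] Prop 2 at the record: the critical configuration has `δ₇`-small plaquettes on the domain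
  have hcritδ : ∀ V ∈ D, PlaqSmall δ₇ (critCfgOfRecord F N θ₀.ν K j V) := fun V hV =>
    hcrit_of_ukExists θ₀.ν hεreg hε3 hε2 (by rw [hδ₇, div_mul_cancel₀ _ (by positivity)]) (hsolν j hj V hV)
  -- the plaquette functions of the critical configuration, continuous within the domain at `V₀`
  set Fp : Plaq (F.P K) j → (PBond (F.P K) (j + 1) → SU N) → ℝ := fun p V => dist1 (GaugeField.plaqHol (critCfgOfRecord F N θ₀.ν K j V) p)
    with hFp
  have hFcont : ∀ p, ContinuousWithinAt (Fp p) D V₀ := fun p =>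
    ((continuous_dist1_SU.comp (continuous_plaqHol_SU p)).continuousAt.comp_continuousWithinAt (hcrit V₀ hV₀))
  -- margins `m p < δ₇` with `Fp p V < m p` near `V₀`, and their finite supremum `M < δ₇`
  set m : Plaq (F.P K) j → ℝ := fun p => (Fp p V₀ + δ₇) / 2 with hm
  have hm_lt : ∀ p, m p < δ₇ := fun p => by
    have h := hcritδ V₀ hV₀ p
    simp only [hm, hFp] at h ⊢
    linarith
  have hFm : ∀ p, Fp p V₀ < m p := fun p => by
    have h := hcritδ V₀ hV₀ p
    simp only [hm, hFp] at h ⊢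
    linarith
  set M : ℝ := ⨆ p, m p with hM
  have hM_lt : M < δ₇ := by
    rcases isEmpty_or_nonempty (Plaq (F.P K) j) with hE | hNE
    · rw [hM, Real.iSup_of_isEmpty]; exact hδ₇pos
    · obtain ⟨p, hp⟩ := exists_eq_ciSup_of_finite (f := m)
      rw [hM, ← hp]; exact hm_lt p
  have hmM : ∀ p, m p ≤ M := fun p => le_ciSup (Finite.bddAbove_range m) p
  have hε''0 : 0 ≤ ε'' := hε29.trans (le_max_left _ _)
  -- the compact `C` and the bound
  refine ⟨{U : GaugeField (F.P K) j (SU N) | ∀ p : Plaq (F.P K) j, dist1 (GaugeField.plaqHol U p) ≤ M + 4 * ε''},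
    plaqBall_subset_domAlt θ₀.ν K j (by rw [hδ₇] at hM_lt; linarith), isCompact_plaqBall _,
    fun _ => ((B : ℝ≥0) : ℝ) ^ Fintype.card (PBond (F.P K) (j + 1)), integrable_const _, ?_⟩
  -- near `V₀` within the domain
  have hev : ∀ᶠ V in 𝓝[D] V₀, ∀ p, Fp p V < m p :=
    eventually_all.2 fun p => (hFcont p).eventually_lt_const (hFm p)
  filter_upwards [hev, eventually_mem_nhdsWithin] with V hVm hVD
  refine Filter.Eventually.of_forall fun z => ⟨towerJacobian_le_pow T ϑ jd _ hjdB (V, z), fun p => ?_⟩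
  by_cases hAz : (V, z) ∈ {p : ((PBond (F.P K) (j + 1) → SU N) × GaugeField (F.P K) j (SU N)) |
          ({q : ((PBond (F.P K) (j + 1) → SU N) × GaugeField (F.P K) j (SU N)) | ∀ c, q.1 c ∈ T c q.2}.indicator fun q => ∏ c, jd c q.2 (q.1 c)) p ≠ 0 ∧
            (extend centralBond (fun c => ϑ c p.2 (p.1 c)) p.2 : GaugeField (F.P K) j (SU N)) ∈
              {U : GaugeField (F.P K) j (SU N) | chiFixed29 F N θ₀.ν θ₀.ε₂₉ K g j U ≠ 0}}
  · rw [towerChart_eq_of_mem T ϑ jd _ _ hAz]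
    calc dist1 (GaugeField.plaqHol (extend centralBond (fun c => ϑ c z (V c)) z : GaugeField (F.P K) j (SU N)) p)
        ≤ dist1 (GaugeField.plaqHol (critCfgOfRecord F N θ₀.ν K j V) p) + 4 * ε'' :=
          dist1_plaqHol_triChart_le_of_mem_rebaseSet T ϑ jd θ₀ g hj hright hεreg hε3 hε2 hε29 hn1 hn2 hsolν hVD hAz p
      _ ≤ M + 4 * ε'' := by have := (hVm p).le.trans (hmM p); simp only [hFp] at this; linarith
  · rw [towerChart_eq_of_not_mem T ϑ jd _ _ hAz]
    have := (hVm p).le.trans (hmM p)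
    simp only [hFp] at this
    linarith

end Summit.QuantumFields.YangMills.BalabanUVNodes.N09TowerConfinementOfPerBondCharts

end
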